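import Summits.QuantumFields.GaugeBoot.HankelDominance
import Summits.QuantumFields.GaugeBoot.WilsonLoopLimitMonotone
import HarnessLib

/-!
# Difference-Hankel blocks of Wilson-loop expectations at infinite-volume limit points (class LIMIT)

Cell `pub-gaugeboot`, seat lean3 gen 6; the INSTANTIATION section of the formulation lane's sketch
`HOME/pub-gaugeboot-loop/wloops/DiffHankelSketch.lean` (sha256 `1fcbe4695cbef919…`; `LIMIT-SOUNDNESS.md` §S.4 / §L items L-LIM-0,
L-LIM-1) against the tree: Lemma HD (`Summits/QuantumFields/GaugeBoot/HankelDominance.lean`) applied to `f t := ∫ W̄(t × m) dμ` at an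
infinite-volume limit point `μ` along EVEN tori (`Summit.QuantumFields.GaugeBoot.WilsonLoopLimit.*` of `WilsonLoopLimitMonotone.lean`).
HONEST FRAMING: certified bounds on lattice expectations at stated coupling, gauge group, dimension and torus size; NOT a mass gap,
NOT a continuum limit, NOT a string tension; NOT Yang–Mills-summit-bearing (barriers `FixedCouplingUltralocality`,
`PerturbativeInvisibility`). Class LIMIT = limit points of even-side torus states along `L → ∞`; NOT a finite-torus bound, NOT a
continuum-limit or mass-gap statement.
-/

namespace Summit.QuantumFields.GaugeBoot.Hankel

open Finset

/-! ## Instantiation at infinite-volume limit points (LIMIT POINTS ONLY; imports the tree's `WilsonLoopLimit`) -/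

section Limit

open MeasureTheory
open Literature.MathematicalPhysics.QuantumFieldTheory
open Literature.MathematicalPhysics.QuantumLattice (LGConfig IsInfiniteVolumeLimitAlong wilsonLoopObs rectWalk
  normalisedCharacter)
open Literature.RepresentationTheory.CompactGroups
open Summit.QuantumFields.GaugeBoot (SU suRep)
open Summit.QuantumFields.GaugeBoot.WilsonLoopLimit

variable {D N : ℕ} [NeZero D]

/-- **HD-D0 at a limit point** (LIMIT-SOUNDNESS §S.3): for a limit point `μ` of the torus Wilson states along even
tori at coupling `β/N ≥ 0`, every SITE-type difference-Hankel block
`[∫ W̄((a+b) × m) dμ − ∫ W̄((a+b+1) × m) dμ]_{a,b ∈ S}` is positive semidefinite.  Inputs: the tree theorems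
`wilsonLoop_integral_limit_gram_even` (all Hankel blocks) and `wilsonLoop_integral_limit_hankel` (`0 ≤ f ≤ 1`),
combined by `hankel_sub_shift_nonneg` (Lemma HD).  NOT a finite-torus statement. -/
theorem wilsonLoop_integral_limit_hankelDiff_site {β : ℝ} (hβ : 0 ≤ β) {Lk : ℕ → ℕ} (hmono : StrictMono Lk)
    (heven : ∀ k, Even (Lk k + 1)) {μ : Measure (LGConfig D (SU N))}
    (hμ : IsInfiniteVolumeLimitAlong (suRep N) (β / N) Lk μ) {j : Fin D} (hj : j ≠ 0) (m : ℕ)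
    (S : Finset ℕ) (c : ℕ → ℝ) :
    0 ≤ ∑ a ∈ S, ∑ b ∈ S, c a * c b *
      ((∫ U, wilsonLoopObs (normalisedCharacter N ∘ suRep N)
          (rectWalk (0 : Literature.Probability.LatticeModels.Site D) 0 j (a + b) m) U ∂μ) -
        ∫ U, wilsonLoopObs (normalisedCharacter N ∘ suRep N)
          (rectWalk (0 : Literature.Probability.LatticeModels.Site D) 0 j (a + b + 1) m) U ∂μ) := by
  let f : ℕ → ℝ := fun t =>
    ∫ U, wilsonLoopObs (normalisedCharacter N ∘ suRep N)
      (rectWalk (0 : Literature.Probability.LatticeModels.Site D) 0 j t m) U ∂μ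
  obtain ⟨h0, h1, -⟩ := wilsonLoop_integral_limit_hankel hβ hmono heven hμ hj m
  have h0' : ∀ t, 0 ≤ f t := h0
  have h1' : ∀ t, f t ≤ 1 := h1
  have hb : ∀ t, |f t| ≤ 1 := fun t => abs_le.2 ⟨neg_one_lt_zero.le.trans (h0' t), h1' t⟩
  have hp : ∀ (S : Finset ℕ) (c : ℕ → ℝ), 0 ≤ ∑ a ∈ S, ∑ b ∈ S, c a * c b * f (a + b) :=
    fun S c => wilsonLoop_integral_limit_gram_even hmono heven hμ hj m S c
  exact hankel_sub_shift_nonneg f hb hp S c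

/-- **HD-D1 at a limit point** (LIMIT-SOUNDNESS §S.3): the LINK-type difference-Hankel block
`[∫ W̄((a+b+1) × m) dμ − ∫ W̄((a+b+2) × m) dμ]_{a,b ∈ S} ⪰ 0`, from `wilsonLoop_integral_limit_gram_odd`
(all link Hankel blocks, `β ≥ 0`) and `0 ≤ f ≤ 1`, via Lemma HD applied to `t ↦ f (t+1)`.  LIMIT POINTS ONLY. -/
theorem wilsonLoop_integral_limit_hankelDiff_link {β : ℝ} (hβ : 0 ≤ β) {Lk : ℕ → ℕ} (hmono : StrictMono Lk)
    (heven : ∀ k, Even (Lk k + 1)) {μ : Measure (LGConfig D (SU N))}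
    (hμ : IsInfiniteVolumeLimitAlong (suRep N) (β / N) Lk μ) {j : Fin D} (hj : j ≠ 0) (m : ℕ)
    (S : Finset ℕ) (c : ℕ → ℝ) :
    0 ≤ ∑ a ∈ S, ∑ b ∈ S, c a * c b *
      ((∫ U, wilsonLoopObs (normalisedCharacter N ∘ suRep N)
          (rectWalk (0 : Literature.Probability.LatticeModels.Site D) 0 j (a + b + 1) m) U ∂μ) -
        ∫ U, wilsonLoopObs (normalisedCharacter N ∘ suRep N)
          (rectWalk (0 : Literature.Probability.LatticeModels.Site D) 0 j (a + b + 2) m) U ∂μ) := by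
  let f : ℕ → ℝ := fun t =>
    ∫ U, wilsonLoopObs (normalisedCharacter N ∘ suRep N)
      (rectWalk (0 : Literature.Probability.LatticeModels.Site D) 0 j t m) U ∂μ
  obtain ⟨h0, h1, -⟩ := wilsonLoop_integral_limit_hankel hβ hmono heven hμ hj m
  have h0' : ∀ t, 0 ≤ f t := h0
  have h1' : ∀ t, f t ≤ 1 := h1
  have hb : ∀ t, |f t| ≤ 1 := fun t => abs_le.2 ⟨neg_one_lt_zero.le.trans (h0' t), h1' t⟩
  have hq : ∀ (S : Finset ℕ) (c : ℕ → ℝ), 0 ≤ ∑ a ∈ S, ∑ b ∈ S, c a * c b * f (a + b + 1) :=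
    fun S c => wilsonLoop_integral_limit_gram_odd hβ hmono heven hμ hj m S c
  exact hankel_sub_shift_nonneg_succ f hb hq S c

end Limit

/-! ## L-LIM-0: limit points along EVEN tori exist (non-vacuity of class LIMIT; `LIMIT-SOUNDNESS.md` §S.7)

The tree's `Literature.MathematicalPhysics.QuantumLattice.infiniteVolumeLimitPoints_nonempty_holds` run on the
subsequence of even torus sides `2n + 2`: compactness of `ProbabilityMeasure (G^{edges(ℤ^d)})` gives a convergent
sub-subsequence, and `Lk k := 2 φ(k) + 1` has `Lk k + 1 = 2 φ(k) + 2` even.  Generic compact second-countable `G`,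
continuous `ρ`, every `β` — exactly the hypotheses of the tree fact. -/

section EvenLimitPoints

open MeasureTheory Filter Topology
open Literature.MathematicalPhysics.QuantumFieldTheory
open Literature.MathematicalPhysics.QuantumLattice (LGConfig toTorusObservable IsInfiniteVolumeLimitAlong)

variable {d N : ℕ} {G : Type*} [Group G] [TopologicalSpace G] [IsTopologicalGroup G]
  [CompactSpace G] [MeasurableSpace G] [BorelSpace G] (ρ : G →* Matrix (Fin N) (Fin N) ℂ)

/-- **L-LIM-0.** For a continuous representation `ρ` of a compact second-countable Hausdorff group `G` and every
`β`, there are a probability measure `μ` on `G^{edges(ℤ^d)}` and a strictly increasing `Lk` with every torus side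
`Lk k + 1` EVEN such that the torus Wilson states of side `Lk k + 1` converge to `μ` on bounded continuous cylinder
observables (`IsInfiniteVolumeLimitAlong ρ β Lk μ`).  [Seiler LNP 159 Ch. 2 / Chatterjee arXiv:1803.01950 §2,
by compactness — as `infiniteVolumeLimitPoints_nonempty_holds`, on the even subsequence.] -/
theorem exists_isInfiniteVolumeLimitAlong_even [T2Space G] [SecondCountableTopology G]
    (hρ : Continuous ρ) (β : ℝ) :
    ∃ (μ : Measure (LGConfig d G)) (Lk : ℕ → ℕ),
      StrictMono Lk ∧ (∀ k, Even (Lk k + 1)) ∧ IsInfiniteVolumeLimitAlong ρ β Lk μ := by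
  haveI := fun L : ℕ => isProbabilityMeasure_torusState (d := d) (L := L + 1) ρ hρ β
  let P : ℕ → ProbabilityMeasure (LGConfig d G) := fun n =>
    ⟨torusState ρ β (2 * n + 1 + 1), inferInstance⟩
  obtain ⟨μ, -, φ, hφ, hlim⟩ :=
    (isCompact_univ (X := ProbabilityMeasure (LGConfig d G))).tendsto_subseq
      fun n => Set.mem_univ (P n)
  refine ⟨(μ : Measure (LGConfig d G)), fun k => 2 * φ k + 1,
    fun a b hab => by have h := hφ hab; dsimp only; omega,
    fun k => ⟨φ k + 1, by ring⟩, inferInstance, fun F S _ hFc hFb => ?_⟩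
  obtain ⟨C, hC⟩ := hFb
  let Fb : BoundedContinuousFunction (LGConfig d G) ℝ :=
    BoundedContinuousFunction.ofNormedAddCommGroup F hFc C
      (fun U => by simpa [Real.norm_eq_abs] using hC U)
  show Tendsto (fun k : ℕ => wilsonExpectation (L := 2 * φ k + 1 + 1) ρ β
      (toTorusObservable (2 * φ k + 1 + 1) F)) atTop (𝓝 (∫ U, F U ∂(μ : Measure (LGConfig d G))))
  have hE : (fun k : ℕ => wilsonExpectation (L := 2 * φ k + 1 + 1) ρ β
      (toTorusObservable (2 * φ k + 1 + 1) F)) =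
      fun k => ∫ U, Fb U ∂(P (φ k) : Measure (LGConfig d G)) :=
    funext fun k => wilsonExpectation_toTorusObservable ρ β (2 * φ k + 1 + 1) hFc.measurable
  have key : Tendsto (fun k : ℕ => ∫ U, Fb U ∂(P (φ k) : Measure (LGConfig d G))) atTop
      (𝓝 (∫ U, Fb U ∂(μ : Measure (LGConfig d G)))) :=
    (ProbabilityMeasure.tendsto_iff_forall_integral_tendsto.1 hlim) Fb
  rw [hE]
  exact key

end EvenLimitPoints

end Summit.QuantumFields.GaugeBoot.Hankel
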